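import Literature.AlgebraicGeometry.Motives.HodgeStructureLefschetzGroupEnvelopingAlgebra
import Literature.AlgebraicGeometry.Motives.HodgeGroupCommutativeIffCMPoints
import Literature.AlgebraicGeometry.Motives.HodgeStructureCentralizerFiniteDirectSumPoints
import Literature.AlgebraicGeometry.Motives.HodgeStructureCentralizerEquivariantFormsSpanPoints
import Literature.AlgebraicGeometry.Motives.HodgeTensorFactsHolds
import HarnessLib

/-!
# Milne 1999 §3 p. 653 "the `k`-algebra `C(A)` is generated by the `γ ∈ S(A)(k)`" UNCONDITIONALLY on `K`-points:
# `K[S(H)(K)] = C(H)(K)` for EVERY polarized `ℚ`-Hodge structure and EVERY field `K ⊇ ℚ` — through the Hodge group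
# (`Hg(H) ≤ S(H)`, Jacobson density) and "centralisers commute with extension of scalars" (Remark 1.6); hence Propositions
# 1.3 and 3.3 (`r = 1`) on `K`-points literally as printed, with `C(A)` the `K`-algebra and any field `K ⊇ ℚ`

[topic AlgebraicGeometry/Motives]

Layer `Literature/AlgebraicGeometry/Motives`, lane `lit-hodgefound` (Track 2 foundations library; seat `lit-hodgefound-p34`,
generation 24, self-proposed row g24-#5), namespace `Literature.AlgebraicGeometry.Motives.HodgeStructure`. THEOREMS ONLY; no
definition, no named fact, no `sorry` (D-0026, net debt `0`).

WHAT THIS FILE SETTLES. The seat's gen-23/24 files (`…EndAlgCentralizerUnitaryGeneration` g23-#5, `…EndAlgCentralizerTwistedBlocks`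
g24-#1, `…CentralizerFiniteDirectSumPoints` g24-#2, `…CentralizerTransportPoints` g24-#3, `…LefschetzGroupGeneratesCentralizer`
g24-#4) prove `K[S(H)(K)] = C(H)(K)` along MILNE'S road (Lemma 3.5: the structure of `(C(A) ⊗ k^al, †)` type by type, unitary
generation of the model algebras) — for `K` algebraically closed and under Albert-type hypotheses on the summands. The seat's
gen-18 file `…LefschetzGroupEnvelopingAlgebra` (g18-#7) had already recorded the OTHER road, valid for every polarized `H` and
every field `K ⊇ ℚ`: `Hg(H)(K) ≤ S(H)(K)` and `K[Hg(H)(K)]` has underlying `K`-module `C(H) ⊗ K = span_K {c_K : c ∈ C(H)}`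
(Jacobson density on the `Hg(H)(K)`-module `K ⊗ V`, Deligne's "`E` is the commutant of `G`"), so that
`K[S(H)(K)] = K[Hg(H)(K)]` with underlying module `C(H) ⊗ K` (`Polarization.adjoin_lefschetzGroupBaseChange_toSubmodule_eq_span`).
The one identification missing to read this as Milne's sentence for the `K`-ALGEBRA `C(H)(K) = Z_{End_K(K ⊗ V)}({a_K : a ∈ E_φ})`
is Remark 1.6, "`C'(A) ≅ C(A) ⊗_k k'`": `C(H)(K) = C(H) ⊗ K` as `K`-submodules of `End_K(K ⊗ V)` — centralisers commute with
extension of scalars, the tree's `forall_baseChange_comm_iff_mem_span_baseChange_centralizer` (`Motives/HodgeGroupCommutativeIffCMPoints`,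
flatness of `K/ℚ`). This file makes that identification and draws the consequences: the sentence holds with NO hypothesis on
`K` or on the type of `E_φ`, hence so do the hypotheses `hS` of g24-#2 / g24-#4 and — read through g24-#2's
`Polarization.adjoin_setOf_centralizerAdjoint_mul_self_eq_one_eq_top_iff` — `(C(H)(K), †)` is generated by its unitary elements
over EVERY field `K ⊇ ℚ` (for these algebras with involution; Milne's Lemma 3.5 needs `k` algebraically closed in general).
The type-by-type files keep their own content (the STRUCTURE of `(C(H)(K), †)`, Milne §2; Lemma 3.5 for the model pairs,
`Literature/RingTheory/SimpleModule/InvolutionUnitaryGeneration`), but their headline is superseded by §2 below.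

## The source, verbatim

J. S. Milne, *Lefschetz classes on abelian varieties*, Duke Math. J. **96** (1999) 639–675 [Milne1999LefschetzClasses] (held
text `paper:doi-10-1215-s0012-7094-99-09620-5`; Duke page = folio + 638):
* §3 p. 653 (p0015 L42–L46): "The next lemma shows that the `k`-algebra `C(A)` is generated by the `γ ∈ S(A)(k)`, and so
  Proposition 3.3 follows from Proposition 1.3. **Lemma 3.5.** Any semisimple algebra with involution `(R, †)` of finite
  dimension over an algebraically closed field `k` is generated (as a `k`-algebra) by the subset `U` of elements `u`
  satisfying `u†u = 1`."
* §1 p. 644 (p0006 L30–L34): "**Remark 1.6.** If `X ↦ H*(X)` is a Weil cohomology theory with coefficient field `k`, and `k'`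
  is a field containing `k`, then `X ↦ H*(X) ⊗_k k'` is a Weil cohomology theory with coefficient field `k'`. If `C'(A)`,
  `S'(A)` […] denote the objects […] relative to [it], then `C'(A) ≅ C(A) ⊗_k k'`, `S'(A) ≅ S(A)_{/k'}` […]."
* §4 p. 660 (p0022 L33–L35): "Clearly `D_hom(A) ⊂ H(A)`, and so `L(A) ⊃ Hg(A)`." (The tree's
  `Polarization.hodgeGroupBaseChange_le_lefschetzGroupBaseChange`.)
* P. Deligne, *Hodge cycles on abelian varieties*, LNM 900 (1982), I §3 Prop. 3.1 / 3.4 (proofs: extension of scalars) and §5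
  proof of Prop. 5.1 ("`E` is the commutant of `G` in `End(H₁(A, ℚ))`") — behind g18-#7 and the base-change lemma.

CARRIER (as in all the seat's `K`-points files): `H : HodgeStructure V n`, `Q : Polarization H`, `V` finite-dimensional,
`K ⊇ ℚ` any field (any universe); `E_φ = H.endAlg`, `C(H) = Subalgebra.centralizer ℚ E_φ ⊆ End_ℚ(V)`,
`C(H)(K) = Subalgebra.centralizer K {a_K : a ∈ E_φ} ⊆ End_K(K ⊗ V)`, `S(H)(K) = Q.lefschetzGroupBaseChange K ≤ GL_K(K ⊗ V)`,
`K[·] = Algebra.adjoin K`, `†` on `C(H)(K)` = `Q.centralizerAdjoint K` (g23-#5).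

## What is PROVED

* §1 **Remark 1.6 for `C(A)`**: `Polarization.mem_centralizer_endAlg_baseChange_iff_mem_span` (`c ∈ C(H)(K) ⟺ c ∈ span_K
  {c₀_K : c₀ ∈ C(H)}`) and **`centralizer_endAlg_baseChange_toSubmodule_eq_span`** (`C(H)(K) = C(H) ⊗ K` as `K`-submodules).
* §2 **THE SENTENCE, UNCONDITIONALLY**: **`Polarization.adjoin_coe_lefschetzGroupBaseChange_eq_centralizer_endAlg_baseChange`** —
  `K[S(H)(K)] = C(H)(K)` for every polarized `ℚ`-Hodge structure `(H, Q)` and every field `K ⊇ ℚ`; with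
  `adjoin_coe_hodgeGroupBaseChange_eq_centralizer_endAlg_baseChange` (`K[Hg(H)(K)] = C(H)(K)` for polarizable `H`) and
  `Polarization.mem_adjoin_coe_lefschetzGroupBaseChange_iff` (membership form).
* §3 consequence: **`Polarization.centralizer_adjoin_unitaries_eq_top`** — `(C(H)(K), †)` is generated as a `K`-algebra
  by `{c : c†c = 1}` for EVERY field `K ⊇ ℚ` (g24-#2's iff, its right-hand side now a theorem). The hypotheses `hS i` of
  g24-#2 `…_pi_eq_centralizer` / g24-#4 `…_pi_pi_const_eq_centralizer` are the instances `(Q i).adjoin_coe_…_endAlg_baseChange K`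
  of §2, and so are their conclusions and those of g23-#5 / g24-#1; no sum-of-powers statement is restated.
* §4 Milne's hypothesis with the `K`-ALGEBRA: `Polarization.forall_centralizer_endAlg_baseChange_form_apply_adjointBaseChange_iff`
  ("`ψ ∘ (γ × 1) = ψ ∘ (1 × γ†)` for all `γ ∈ C(H)(K)`" ⟺ the same for the `c_K`, `c ∈ C(H)` rational — the form in which the
  seat's g18-#8 / g20-#5 state Proposition 1.3), hence **Proposition 1.3 on `K`-points literally as printed**,
  **`Polarization.forall_centralizer_endAlg_baseChange_form_apply_adjointBaseChange_and_swap_iff_mem_span`**: the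
  `C(H)(K)`-equivariant `ε`-symmetric `K`-bilinear forms on `K ⊗ V` are exactly `span_K {(Q(s ·, ·))_K : s ∈ E_φ, s† = s}`.
* §5 **Proposition 3.3 (`r = 1`) on `K`-points as printed, every field `K ⊇ ℚ` of any universe** (the seat's g18-#8
  `…_iff_mem_span` needs `K` in the universe of `V`, going through `Hg(H)(K)`):
  `Polarization.forall_lefschetzGroupBaseChange_form_apply_apply_iff_mem_span_baseChange_endAlg` (`Q_K(β ·, ·)` is
  `S(H)(K)`-invariant iff `β ∈ E_φ ⊗ K`), `…_iff_mem_span_baseChange_form_comp` (the `S(H)(K)`-invariant forms are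
  `span_K {(Q(a ·, ·))_K : a ∈ E_φ}`) and **`Polarization.forall_lefschetzGroupBaseChange_form_apply_apply_and_swap_iff_mem_span`**
  (the `S(H)(K)`-invariant `ε`-symmetric forms are exactly `span_K {(Q(s ·, ·))_K : s ∈ E_φ, s† = s}` — "the space of
  skew-symmetric forms invariant under `S(A)` is generated by the forms `e_D`"), with the plumbing
  `Polarization.mem_span_baseChange_form_comp_image_iff` (any `T ⊆ End_ℚ(V)`).

HONEST NOTE. Nothing here uses Lemma 3.5 or algebraic closure: for Hodge structures the Hodge group supplies enough unitary
elements of `C(H)(K)` rationally. Milne works with an arbitrary Weil cohomology (no `ℚ`-structure on `V(A)`, no Hodge group),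
where Lemma 3.5 is needed; the seat's type-by-type files formalize that road. HC is NOT proved; nothing here is a case of it.

## References

* [Milne1999LefschetzClasses] J. S. Milne, *Lefschetz classes on abelian varieties*, Duke Math. J. 96 (1999) 639–675 — §3
  p. 653 L42–L46 (Lemma 3.5 and the sentence before it), §1 Remark 1.6 (p. 644 L30–L34), Remark 1.2 (p. 643), §4 p. 660 L33–L35.
* [Deligne1982HodgeCycles] P. Deligne, *Hodge cycles on abelian varieties*, LNM 900 (1982), I §3 Prop. 3.1, 3.4; §5 Prop. 5.1.
* [MumfordAV1970] D. Mumford, *Abelian varieties* (1970), §20–§21, Application III p. 208 (`NS(A)_ℚ ≅` the Rosati-symmetric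
  part of `End⁰(A)`: the reading of "the forms `e_D`").
-/

noncomputable section

open scoped TensorProduct

namespace Literature.AlgebraicGeometry.Motives

namespace HodgeStructure

universe u uK

variable (K : Type uK) [Field K] [Algebra ℚ K] {V : Type u} [AddCommGroup V] [Module ℚ V] [Module.Finite ℚ V]
  {n : ℤ} {H : HodgeStructure V n} (Q : Polarization H)

/-! ## §1 Remark 1.6: `C(H)(K) = C(H) ⊗ K` inside `End_K(K ⊗ V)` -/

variable (H) in
/-- **Remark 1.6 for the centraliser, membership form**: a `K`-linear endomorphism of `K ⊗ V` commutes with every `a_K`,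
`a ∈ E_φ` — i.e. lies in `C(H)(K)` — iff it is a `K`-linear combination of base changes `c_K` of RATIONAL elements
`c ∈ C(H)` ("`C'(A) ≅ C(A) ⊗_k k'`"; centralisers commute with extension of scalars, the tree's
`forall_baseChange_comm_iff_mem_span_baseChange_centralizer`). [cite: Milne1999LefschetzClasses, §1 Remark 1.6 (p. 644 L30–L34)]
[cite: Deligne1982HodgeCycles, I §3 Prop. 3.1 (proof: extension of scalars)] -/
theorem mem_centralizer_endAlg_baseChange_iff_mem_span (c : Module.End K (K ⊗[ℚ] V)) :
    c ∈ Subalgebra.centralizer K ((fun a : Module.End ℚ V ↦ a.baseChange K) '' (H.endAlg : Set (Module.End ℚ V))) ↔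
      c ∈ Submodule.span K ((fun c₀ : Module.End ℚ V ↦ c₀.baseChange K) ''
        (Subalgebra.centralizer ℚ (H.endAlg : Set (Module.End ℚ V)) : Set (Module.End ℚ V))) := by
  rw [← forall_baseChange_comm_iff_mem_span_baseChange_centralizer K (H.endAlg : Set (Module.End ℚ V)) c,
    Subalgebra.mem_centralizer_iff]
  constructor
  · intro h a ha
    exact (h (a.baseChange K) ⟨a, ha, rfl⟩).symm
  · rintro h _ ⟨a, ha, rfl⟩
    exact (h a ha).symm

variable (H) in
/-- **Remark 1.6, "`C'(A) ≅ C(A) ⊗_k k'`"**: the underlying `K`-submodule of `C(H)(K) ⊆ End_K(K ⊗ V)` is the `K`-span of the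
base changes of `C(H)`. [cite: Milne1999LefschetzClasses, §1 Remark 1.6 (p. 644 L30–L34)]
[cite: Deligne1982HodgeCycles, I §3 Prop. 3.1 (proof: extension of scalars)] -/
theorem centralizer_endAlg_baseChange_toSubmodule_eq_span :
    Subalgebra.toSubmodule
        (Subalgebra.centralizer K ((fun a : Module.End ℚ V ↦ a.baseChange K) '' (H.endAlg : Set (Module.End ℚ V)))) =
      Submodule.span K ((fun c₀ : Module.End ℚ V ↦ c₀.baseChange K) ''
        (Subalgebra.centralizer ℚ (H.endAlg : Set (Module.End ℚ V)) : Set (Module.End ℚ V))) :=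
  Submodule.ext fun c ↦ by rw [Subalgebra.mem_toSubmodule, mem_centralizer_endAlg_baseChange_iff_mem_span K H c]

/-! ## §2 "The `k`-algebra `C(A)` is generated by the `γ ∈ S(A)(k)`" — every polarized `H`, every field `K ⊇ ℚ` -/

/-- **`K[S(H)(K)] = C(H)(K)` for EVERY polarized `ℚ`-Hodge structure and EVERY field `K ⊇ ℚ`** ("the `k`-algebra `C(A)` is
generated by the `γ ∈ S(A)(k)`", here with no algebraic closure and no hypothesis on the Albert type): the two `K`-subalgebras
of `End_K(K ⊗ V)` have the same underlying `K`-submodule `C(H) ⊗ K` — §1 for `C(H)(K)`, and g18-#7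
`Polarization.adjoin_lefschetzGroupBaseChange_toSubmodule_eq_span` for `K[S(H)(K)] = K[Hg(H)(K)]` (`Hg(H) ≤ S(H)` and Jacobson
density; its `HodgeTensorFacts` instance is the tree's theorem `hodgeTensorFacts_holds`).
[cite: Milne1999LefschetzClasses, §3 p. 653 L42–L46 with §1 Remark 1.6 (p. 644) and §4 p. 660 L33–L35 ("L(A) ⊃ Hg(A)")]
[cite: Deligne1982HodgeCycles, I §5 proof of Prop. 5.1 ("E is the commutant of G")] -/
theorem Polarization.adjoin_coe_lefschetzGroupBaseChange_eq_centralizer_endAlg_baseChange :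
    Algebra.adjoin K ((fun γ : (K ⊗[ℚ] V) ≃ₗ[K] (K ⊗[ℚ] V) ↦ (γ : Module.End K (K ⊗[ℚ] V))) ''
        (Q.lefschetzGroupBaseChange K : Set _)) =
      Subalgebra.centralizer K ((fun a : Module.End ℚ V ↦ a.baseChange K) '' (H.endAlg : Set (Module.End ℚ V))) := by
  haveI : HodgeTensorFacts.{u, u} := hodgeTensorFacts_holds
  exact Subalgebra.toSubmodule_injective ((Q.adjoin_lefschetzGroupBaseChange_toSubmodule_eq_span K).trans
    (centralizer_endAlg_baseChange_toSubmodule_eq_span K H).symm)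

variable (H) in
/-- **`K[Hg(H)(K)] = C(H)(K)`** for every polarizable `ℚ`-Hodge structure and every field `K ⊇ ℚ`: the Hodge group alone
generates Milne's `K`-algebra `C(A) ⊗ K` (the tree's `adjoin_hodgeGroupBaseChange_toSubmodule_eq_span`, Jacobson density on
`K`-points, with §1; the instance hypothesis `[HodgeTensorFacts]`, through which `Hg(H)(K)` is defined, is the tree's theorem
`hodgeTensorFacts_holds`). [cite: Milne1999LefschetzClasses, §3 p. 653 L42–L46 and §4 p. 660 L33–L35] [cite: Deligne1982HodgeCycles, I §5 proof of Prop. 5.1] -/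
theorem adjoin_coe_hodgeGroupBaseChange_eq_centralizer_endAlg_baseChange [HodgeTensorFacts.{u, u}] (hH : H.IsPolarizable) :
    Algebra.adjoin K ((fun γ : (K ⊗[ℚ] V) ≃ₗ[K] (K ⊗[ℚ] V) ↦ (γ : Module.End K (K ⊗[ℚ] V))) ''
        (H.hodgeGroupBaseChange K : Set _)) =
      Subalgebra.centralizer K ((fun a : Module.End ℚ V ↦ a.baseChange K) '' (H.endAlg : Set (Module.End ℚ V))) :=
  Subalgebra.toSubmodule_injective ((adjoin_hodgeGroupBaseChange_toSubmodule_eq_span H K hH).trans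
    (centralizer_endAlg_baseChange_toSubmodule_eq_span K H).symm)

/-- **Membership form**: a `K`-linear endomorphism of `K ⊗ V` lies in the `K`-algebra generated by `S(H)(K)` iff it commutes
with every `a_K`, `a ∈ E_φ`. [cite: Milne1999LefschetzClasses, §3 p. 653 L42–L46 with §1 Remark 1.6 (p. 644)] -/
theorem Polarization.mem_adjoin_coe_lefschetzGroupBaseChange_iff (c : Module.End K (K ⊗[ℚ] V)) :
    c ∈ Algebra.adjoin K ((fun γ : (K ⊗[ℚ] V) ≃ₗ[K] (K ⊗[ℚ] V) ↦ (γ : Module.End K (K ⊗[ℚ] V))) ''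
        (Q.lefschetzGroupBaseChange K : Set _)) ↔
      ∀ a ∈ H.endAlg, c * a.baseChange K = a.baseChange K * c := by
  rw [Q.adjoin_coe_lefschetzGroupBaseChange_eq_centralizer_endAlg_baseChange K, Subalgebra.mem_centralizer_iff]
  constructor
  · intro h a ha
    exact (h (a.baseChange K) ⟨a, ha, rfl⟩).symm
  · rintro h _ ⟨a, ha, rfl⟩
    exact (h a ha).symm

/-! ## §3 Consequence: unitary generation of `(C(H)(K), †)` over every `K ⊇ ℚ` -/

/-- **`(C(H)(K), †)` is generated as a `K`-algebra by its unitary elements `{c : c†c = 1}`, for EVERY polarized `ℚ`-Hodge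
structure and EVERY field `K ⊇ ℚ`** — the unitary elements of `C(H)(K)` are exactly `S(H)(K)` (g23-#5
`Polarization.image_coe_lefschetzGroupBaseChange_eq`, "`S(A)(R) = {γ ∈ C(A) ⊗_k R | γ†γ = 1}`"), so this is §2 read through
g24-#2's `Polarization.adjoin_setOf_centralizerAdjoint_mul_self_eq_one_eq_top_iff`. For these algebras with involution no
algebraic closure is needed (Milne's Lemma 3.5 is stated over `k` algebraically closed).
[cite: Milne1999LefschetzClasses, §3 Lemma 3.5 (p. 653 L44–L46) and §1 p. 644 L18] -/
theorem Polarization.centralizer_adjoin_unitaries_eq_top :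
    Algebra.adjoin K {c : Subalgebra.centralizer K ((fun a : Module.End ℚ V ↦ a.baseChange K) ''
        (H.endAlg : Set (Module.End ℚ V))) | Q.centralizerAdjoint K c * c = 1} = ⊤ :=
  (Q.adjoin_setOf_centralizerAdjoint_mul_self_eq_one_eq_top_iff K).2
    (Q.adjoin_coe_lefschetzGroupBaseChange_eq_centralizer_endAlg_baseChange K)

/-! ## §4 Milne's hypothesis "all `γ ∈ C(A)`" with `C(A)` the `K`-ALGEBRA `C(H)(K)`; Proposition 1.3 on `K`-points as printed -/

/-- **"`ψ ∘ (γ × 1) = ψ ∘ (1 × γ†)`, all `γ ∈ C(A)`" for the `K`-algebra `C(A) = C(H)(K)` is equivalent to the same condition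
for the base changes `c_K` of the RATIONAL `c ∈ C(H)`** (the form used by the seat's g18-#8 / g20-#5): `C(H)(K) = C(H) ⊗ K` (§1)
and both sides are `K`-linear in `γ` (`†` is `K`-linear, `Polarization.adjointBaseChange_add/_smul`; `(c_K)† = (c†)_K`,
`Polarization.adjointBaseChange_baseChange`). [cite: Milne1999LefschetzClasses, §1 Prop. 1.3 (p. 643 L34–L36) and Remark 1.6 (p. 644)] -/
theorem Polarization.forall_centralizer_endAlg_baseChange_form_apply_adjointBaseChange_iff
    (B : LinearMap.BilinForm K (K ⊗[ℚ] V)) :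
    (∀ γ ∈ Subalgebra.centralizer K ((fun a : Module.End ℚ V ↦ a.baseChange K) '' (H.endAlg : Set (Module.End ℚ V))),
        ∀ x y, B (γ x) y = B x (Q.adjointBaseChange K γ y)) ↔
      ∀ c ∈ Subalgebra.centralizer ℚ (H.endAlg : Set (Module.End ℚ V)), ∀ x y,
        B (c.baseChange K x) y = B x ((Q.adjoint c).baseChange K y) := by
  constructor
  · intro h c hc x y
    rw [← Q.adjointBaseChange_baseChange K c]
    exact h _ ((mem_centralizer_endAlg_baseChange_iff_mem_span K H _).2 (Submodule.subset_span ⟨c, hc, rfl⟩)) x y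
  · intro h γ hγ
    have hγ' := (mem_centralizer_endAlg_baseChange_iff_mem_span K H γ).1 hγ
    clear hγ
    induction hγ' using Submodule.span_induction with
    | mem γ hmem =>
      obtain ⟨c, hc, rfl⟩ := hmem
      intro x y
      rw [Q.adjointBaseChange_baseChange K c]
      exact h c hc x y
    | zero =>
      intro x y
      rw [Q.adjointBaseChange_zero K, LinearMap.zero_apply, LinearMap.zero_apply, map_zero, LinearMap.zero_apply, map_zero]
    | add γ γ' _ _ hγ hγ' =>
      intro x y
      rw [Q.adjointBaseChange_add K, LinearMap.add_apply, LinearMap.add_apply, map_add, LinearMap.add_apply, map_add,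
        hγ x y, hγ' x y]
    | smul a γ _ hγ =>
      intro x y
      rw [Q.adjointBaseChange_smul K, LinearMap.smul_apply, LinearMap.smul_apply, LinearMap.map_smul₂, map_smul, hγ x y]

/-- **Proposition 1.3 on `K`-points, as printed — "The skew-symmetric `k`-bilinear forms `ψ : V(A) × V(A) → k(1)` such that
`ψ ∘ (γ × 1) = ψ ∘ (1 × γ†)`, all `γ ∈ C(A)`, are exactly the `k`-linear combinations of forms `e_D` with `D` a divisor on
`A`"** — with `C(A)` the `K`-algebra `C(H)(K)` and `γ† = Q.adjointBaseChange K γ` (Milne's involution on `End_K(K ⊗ V)`), any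
weight (parity `ε = (-1)ⁿ`), "the forms `e_D`" read as the base changes `(Q(s ·, ·))_K`, `s ∈ E_φ`, `s† = s` (§4's bridge to
the seat's g20-#5 `Polarization.forall_centralizer_baseChange_form_apply_adjoint_and_swap_iff_mem_span`, whose `HodgeTensorFacts`
instance is the tree's theorem `hodgeTensorFacts_holds`). [cite: Milne1999LefschetzClasses, §1 Prop. 1.3 and its proof (p. 643 L34–L51), Remark 1.6 (p. 644)]
[cite: MumfordAV1970, §20–§21 Application III p. 208] -/
theorem Polarization.forall_centralizer_endAlg_baseChange_form_apply_adjointBaseChange_and_swap_iff_mem_span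
    (B : LinearMap.BilinForm K (K ⊗[ℚ] V)) :
    ((∀ γ ∈ Subalgebra.centralizer K ((fun a : Module.End ℚ V ↦ a.baseChange K) '' (H.endAlg : Set (Module.End ℚ V))),
        ∀ x y, B (γ x) y = B x (Q.adjointBaseChange K γ y)) ∧
        ∀ x y, B y x = (((n.negOnePow : ℤˣ) : ℤ) : K) * B x y) ↔
      B ∈ Submodule.span K ((fun a : Module.End ℚ V ↦ LinearMap.BilinForm.baseChange K (Q.form ∘ₗ a)) ''
        {a | a ∈ H.endAlg ∧ Q.adjoint a = a}) := by
  haveI : HodgeTensorFacts.{u, u} := hodgeTensorFacts_holds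
  rw [Q.forall_centralizer_endAlg_baseChange_form_apply_adjointBaseChange_iff K B]
  exact Q.forall_centralizer_baseChange_form_apply_adjoint_and_swap_iff_mem_span K B

/-! ## §5 Proposition 3.3 (`r = 1`) on `K`-points as printed: the `S(H)(K)`-invariant forms, any field `K ⊇ ℚ` (any universe) -/

omit [Module.Finite ℚ V] in
/-- The set `{a_K : a ∈ E_φ}` written as a range over the subtype (the shape of the seat's g18 files) or as an image.
Private plumbing. [folklore] -/
private theorem range_coe_endAlg_baseChange_eq_image :
    Set.range (fun a : H.endAlg ↦ (a : Module.End ℚ V).baseChange K) =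
      (fun a : Module.End ℚ V ↦ a.baseChange K) '' (H.endAlg : Set (Module.End ℚ V)) := by
  ext f
  simp only [Set.mem_range, Set.mem_image, SetLike.mem_coe, Subtype.exists, exists_prop]

omit [Module.Finite ℚ V] in
/-- **`span_K {(Q(a ·, ·))_K : a ∈ T}` consists of the forms `Q_K(β ·, ·)` with `β ∈ span_K {a_K : a ∈ T}`**, for any set
`T ⊆ End_ℚ(V)` (the map `β ↦ Q_K(β ·, ·)` is `K`-linear; the seat's g20-#5 `mem_span_baseChange_form_comp_iff` is the case
`T = {s ∈ E_φ | s† = s}`). [cite: Milne1999LefschetzClasses, §1 proof of Prop. 1.3 (p. 643 L46–L51)] -/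
theorem Polarization.mem_span_baseChange_form_comp_image_iff (T : Set (Module.End ℚ V))
    (B : LinearMap.BilinForm K (K ⊗[ℚ] V)) :
    B ∈ Submodule.span K ((fun a : Module.End ℚ V ↦ LinearMap.BilinForm.baseChange K (Q.form ∘ₗ a)) '' T) ↔
      ∃ β ∈ Submodule.span K ((fun a : Module.End ℚ V ↦ a.baseChange K) '' T),
        ∀ x y, B x y = Q.form.baseChange K (β x) y := by
  set Φ : Module.End K (K ⊗[ℚ] V) →ₗ[K] LinearMap.BilinForm K (K ⊗[ℚ] V) :=
    LinearMap.llcomp K (K ⊗[ℚ] V) (K ⊗[ℚ] V) ((K ⊗[ℚ] V) →ₗ[K] K) (Q.form.baseChange K) with hΦ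
  have hΦa : ∀ a : Module.End ℚ V, LinearMap.BilinForm.baseChange K (Q.form ∘ₗ a) = Φ (a.baseChange K) := fun a ↦ by
    rw [hΦ, LinearMap.llcomp_apply', Q.baseChange_form_comp K]
  have himage : (fun a : Module.End ℚ V ↦ LinearMap.BilinForm.baseChange K (Q.form ∘ₗ a)) '' T =
      Φ '' ((fun a : Module.End ℚ V ↦ a.baseChange K) '' T) := by
    rw [Set.image_image]
    exact Set.image_congr fun a _ ↦ hΦa a
  rw [himage, Submodule.span_image, Submodule.mem_map]
  refine exists_congr fun β ↦ and_congr Iff.rfl ⟨fun h x y ↦ ?_, fun h ↦ LinearMap.ext fun x ↦ LinearMap.ext fun y ↦ ?_⟩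
  · rw [← h, hΦ, LinearMap.llcomp_apply]
  · rw [hΦ, LinearMap.llcomp_apply, h x y]

/-- **"`ψ` is invariant under `S(A)` if and only if `ψ ∘ (γ × 1) = ψ ∘ (1 × γ†)`, all `γ ∈ S(A)(k)`" ⟹ `β ∈ End⁰(A) ⊗ k`**, on
`K`-points for ANY field `K ⊇ ℚ` (any universe; the seat's g18-#8 `…_iff_mem_span` has `K` in the universe of `V`): for
`B = Q_K(β ·, ·)`, `B` is `S(H)(K)`-invariant iff `β ∈ E_φ ⊗ K` — invariance under the isometry `γ` says `βγ = γβ` (g18-#8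
`forall_apply_apply_iff_comp_eq_comp_of_isometry`) and the commutant of `S(H)(K)` is `E_φ ⊗ K` (g18-#7
`forall_lefschetzGroupBaseChange_comm_iff_mem_span_baseChange_endAlg`; §2: `K[S(H)(K)] = C(H)(K)`).
[cite: Milne1999LefschetzClasses, §3 p. 653 L36–L46 and §1 (1.2), Remark 1.2] -/
theorem Polarization.forall_lefschetzGroupBaseChange_form_apply_apply_iff_mem_span_baseChange_endAlg
    {B : LinearMap.BilinForm K (K ⊗[ℚ] V)} {β : Module.End K (K ⊗[ℚ] V)}
    (hβ : ∀ x y, B x y = Q.form.baseChange K (β x) y) :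
    (∀ γ ∈ Q.lefschetzGroupBaseChange K, ∀ x y, B (γ x) (γ y) = B x y) ↔
      β ∈ Submodule.span K ((fun a : Module.End ℚ V ↦ a.baseChange K) '' (H.endAlg : Set (Module.End ℚ V))) := by
  haveI : HodgeTensorFacts.{u, u} := hodgeTensorFacts_holds
  rw [← range_coe_endAlg_baseChange_eq_image K, ← Q.forall_lefschetzGroupBaseChange_comm_iff_mem_span_baseChange_endAlg K β]
  exact forall₂_congr fun γ hγ ↦ Q.forall_apply_apply_iff_comp_eq_comp_of_isometry K hβ hγ.2

/-- **The `S(H)(K)`-invariant `K`-bilinear forms on `K ⊗ V` are exactly `span_K {(Q(a ·, ·))_K : a ∈ E_φ}`**, for every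
polarized `ℚ`-Hodge structure and every field `K ⊇ ℚ` ("`ψ = e_{D₀} ∘ (β × 1)`", `β ∈ End⁰(A) ⊗ k`; no parity condition).
[cite: Milne1999LefschetzClasses, §3 p. 653 L36–L46 with §1 proof of Prop. 1.3 (p. 643 L41–L46)] -/
theorem Polarization.forall_lefschetzGroupBaseChange_form_apply_apply_iff_mem_span_baseChange_form_comp
    (B : LinearMap.BilinForm K (K ⊗[ℚ] V)) :
    (∀ γ ∈ Q.lefschetzGroupBaseChange K, ∀ x y, B (γ x) (γ y) = B x y) ↔
      B ∈ Submodule.span K ((fun a : Module.End ℚ V ↦ LinearMap.BilinForm.baseChange K (Q.form ∘ₗ a)) ''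
        (H.endAlg : Set (Module.End ℚ V))) := by
  obtain ⟨β, hβ, huniq⟩ := Q.existsUnique_baseChange_form_comp K B
  rw [Q.mem_span_baseChange_form_comp_image_iff K, Q.forall_lefschetzGroupBaseChange_form_apply_apply_iff_mem_span_baseChange_endAlg K hβ]
  exact ⟨fun h ↦ ⟨β, h, hβ⟩, fun ⟨β', hβ', hB'⟩ ↦ (huniq β' hB') ▸ hβ'⟩

/-- **Proposition 3.3 (`r = 1`) on `K`-points, as printed, for EVERY polarized `ℚ`-Hodge structure and EVERY field `K ⊇ ℚ`:
"the space of skew-symmetric forms `ψ : V(A) × V(A) → k(1)` invariant under the action of `S(A)` […] is generated by the forms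
`e_D` with `D` a divisor on `A`"** — the `S(H)(K)`-invariant `ε`-symmetric `K`-bilinear forms on `K ⊗ V` (`ε = (-1)ⁿ`) are
exactly `span_K {(Q(s ·, ·))_K : s ∈ E_φ, s† = s}`. Milne's two steps: invariance under `S(H)(K)` is `†`-equivariance under
`K[S(H)(K)] = C(H)(K)` (§2/§5, here through the commutant), and Proposition 1.3 (the seat's g20-#5; `HodgeTensorFacts` by
`hodgeTensorFacts_holds`). [cite: Milne1999LefschetzClasses, §3 Prop. 3.3 and its proof (p. 653 L28–L46), §1 Prop. 1.3 (p. 643)]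
[cite: MumfordAV1970, §20–§21 Application III p. 208] -/
theorem Polarization.forall_lefschetzGroupBaseChange_form_apply_apply_and_swap_iff_mem_span
    (B : LinearMap.BilinForm K (K ⊗[ℚ] V)) :
    ((∀ γ ∈ Q.lefschetzGroupBaseChange K, ∀ x y, B (γ x) (γ y) = B x y) ∧
        ∀ x y, B y x = (((n.negOnePow : ℤˣ) : ℤ) : K) * B x y) ↔
      B ∈ Submodule.span K ((fun a : Module.End ℚ V ↦ LinearMap.BilinForm.baseChange K (Q.form ∘ₗ a)) ''
        {a | a ∈ H.endAlg ∧ Q.adjoint a = a}) := by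
  haveI : HodgeTensorFacts.{u, u} := hodgeTensorFacts_holds
  obtain ⟨β, hβ, -⟩ := Q.existsUnique_baseChange_form_comp K B
  rw [← Q.forall_centralizer_baseChange_form_apply_adjoint_and_swap_iff_mem_span K B,
    Q.forall_lefschetzGroupBaseChange_form_apply_apply_iff_mem_span_baseChange_endAlg K hβ,
    ← range_coe_endAlg_baseChange_eq_image K, ← Q.forall_centralizer_baseChange_form_apply_adjoint_iff_mem_span K hβ]

end HodgeStructure

end Literature.AlgebraicGeometry.Motives

end
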